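import Mathlib
import Summits.ValiantsHypothesis.ValiantsHypothesis.Theorems.RigidityForcesSymmetryRankRigidMinimalReprLaplaceDefs
import Summits.ValiantsHypothesis.ValiantsHypothesis.Theorems.RigidityForcesSymmetryRankRigidMinimalReprLaplaceFourMain
import Summits.ValiantsHypothesis.ValiantsHypothesis.Theorems.RigidityForcesSymmetryRankRigidMinimalReprLaplaceFourProfile221
import Summits.ValiantsHypothesis.ValiantsHypothesis.Theorems.RigidityForcesSymmetryRankRigidMinimalReprTiedTorusBoundOneTwo

/-!
# `LaplaceOptimal 4` and the rung `TiedTorusBound 3`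
# (crux `RankRigidMinimalRepr`, stmt-ValiantsHypothesis-18034, route `RigidityForcesSymmetry`)

`laplaceOptimal_four`: Laplace expansion is optimal for the `4 × 4` permutation pattern — every split-rank-one
decomposition `P₄ = Σ_t u_t(v|_{S_t}) w_t(v|_{S_tᶜ})` has `Σ_t |S_t|!(4-|S_t|)! ≥ 4! = 24`.  Equivalently: none of the
`19` maximal cheap profiles represents `P₄`; they are refuted across the files `…LaplaceFour*.lean` (Theorem E on slices,
the flattening profiles `(5,0,0)`, `slice+(4,0,0)`, the LINE profiles `(3,2,0)`, `slice+(2,2,0)`, `slice+(3,1,0)`,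
`(3,1,1)`, `slice+(2,1,1)`, the pencil normal form for `(4,1,0)`, and the typing argument for `(2,2,1)`), assembled by
`laplaceOptimal_four_of_profile221`.

`tiedTorusBound_three : TiedTorusBound 3`: the next rung of the line `PairTiedTorusBound` of the crux — Grenet's bound
`2^m - 1 ≤ n` for affine determinantal representations of `perm_m` (`m ≥ 3`) equivariant under the two-sided torus with
the first four column scalars tied (`grenetBound_of_laplaceOptimal (k := 3)`; for `m = 3` the rung `k = 2`).

HONEST FRAMING: `LaplaceOptimal 4` is a finite tensor statement and `TiedTorusBound 3` a rung of the line; the crux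
`RankRigidMinimalRepr` stays OPEN and nothing here bears on `VP ≠ VNP`.
-/

set_option autoImplicit false

-- the mandated summit-side namespace repeats a component by design (single-problem summit)
set_option linter.dupNamespace false

open Literature.Computability.AlgebraicComplexity
open Summit.ValiantsHypothesis.ValiantsHypothesis.Theorems.RigidityForcesSymmetryPairTiedTorusBound

namespace Summit.ValiantsHypothesis.ValiantsHypothesis.Theorems.RigidityForcesSymmetryRankRigidMinimalRepr

/-- **Laplace expansion is optimal for the `4 × 4` permutation pattern.** -/
theorem laplaceOptimal_four : LaplaceOptimal 4 :=
  LaplaceFourLine.laplaceOptimal_four_of_profile221 LaplaceFourLine.profile_221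

/-- **The rung `TiedTorusBound 3`, unconditionally**: Grenet's bound `2^m - 1 ≤ n` (`m ≥ 3`) for affine determinantal
representations of `perm_m` equivariant under the two-sided torus with the column scalars `e_0 = e_1 = e_2 = e_3` tied. -/
theorem tiedTorusBound_three : TiedTorusBound 3 := by
  intro m hm n A hA
  by_cases h4 : 4 ≤ m
  · exact grenetBound_of_laplaceOptimal laplaceOptimal_four m hm h4 n A hA
  · have h3 : m = 3 := by omega
    subst h3
    exact grenetBound_of_laplaceOptimal (k := 2) laplaceOptimal_three 3 hm le_rfl n A
      (hA.anti (tiedTorus_sub_one_le 3 3))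

end Summit.ValiantsHypothesis.ValiantsHypothesis.Theorems.RigidityForcesSymmetryRankRigidMinimalRepr
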